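import Literature.NumberTheory.LFunctions.FordLemma51Core
import HarnessLib

/-!
# Ford's Lemma 5.1: `S(N,t)` through `J_{r,k}(M₁)` and the incomplete system `J_{s,g,h}(ℬ)`

Topic `Literature/NumberTheory/LFunctions`.  Everything in this file is PROVED; no named fact is
introduced (the only `def` is Ford's `W_j`, `FordVK.Wj`).

K. Ford, *Vinogradov's integral and bounds for the Riemann zeta function*, Proc. LMS 85 (2002),
**Lemma 5.1** (Vinogradov's method with the separation of variables `c_i, d_i` that admits
incomplete systems): for integers `k, r, s`, exponents `h ≤ g`, `1 ≤ M₁, M₂ ≤ N` (`M = ⌊M₁⌋`) and a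
nonempty set `ℬ` of positive integers `≤ M₂`,

  `S(N,t) ≤ 2M₁M₂ + t(M₁M₂)^{k+1}/(kN^k)`
  `  + N (M₂/|ℬ|)^{1/r} ((5r)^k M₂^{-2s} M^{-2r+k(k+1)/2} J_{r,k}(M) J_{s,g,h}(ℬ) W_h ⋯ W_g)^{1/(2rs)}`,
  `W_j = min(2sM₂^j, 2sM₂^j/(rM^j) + stM₂^j/(πjN^j) + 4πj(2N)^j/(rtM^j) + 2)`.

`FordVK.ford_lemma51` proves it in the equivalent form "third term `= (N/(M|ℬ|)) Q^{1/(2rs)}`,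
`Q = |ℬ|^{2rs-2s} M^{2rs-2r} J_{r,k}(M) (5r)^k M^{k(k+1)/2} J_{s,k,[h,g]}(ℬ) ∏_{j=h}^g W_j`"
(multiply out: `(M₂/|ℬ|)^{1/r} (M₂^{-2s} M^{-2r})^{1/(2rs)} = |ℬ|^{-1/r} M^{-1/s}`), with Ford's own
`(k+1)N^k` of (5.2) in place of `kN^k`, and with the hypothesis `M₁M₂ ≤ N` under which (5.1)
(`|log(1+x) - ∑_{j≤k} (-1)^{j-1}x^j/j| ≤ x^{k+1}/(k+1)`, `0 ≤ x ≤ 1`) is applied to `x = ab/z`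
(in §5, `M₁M₂ = N^{0.3508}`).

Steps (as printed): the bilinear shift over `a ≤ M₁`, `b ∈ ℬ` (`FordVK.bilinearShift`); the Taylor
step (5.1)–(5.2) (`FordVK.abs_phi_gam_le`, the remainder `φ` of `FordVinogradovBridge.lean` at
`β = γ`, through the monotonicity of `w ↦ (t/2π)w^{k+1}/((k+1)z^{k+1}) ∓ φ(w)`); Hölder twice and
the smoothing (5.3)–(5.5) (`FordVK.norm_U_pow_le`, `FordLemma51Core.lean`); and `|𝒟_j| ≤ W_j` from
(5.6) (`FordVK.card_Dj_le_Wj`, with `K = s(⌊M₂⌋^j - 1)`, `δ = 1/(2rM^j)`, `γ = |γ_j(z)| = t/(2πjz^j)`,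
`N ≤ z ≤ 2N`).

This is the bridge of §5: with Theorem 3 (explicit Vinogradov mean value) for `J_{r,k}` and
Theorem 4 (incomplete systems over `𝒞(P,R)`) for `J_{s,g,h}`, it gives Theorem 2 for `λ ≥ 87`
(Lemmas 5.2–5.3), the large-`λ` part of the remaining input of
`zeta_bound_ford_of_exp_sum_bound_large_lambda` (`FordExpSumSmallLambda.lean`).

## References

* K. Ford, *Vinogradov's integral and bounds for the Riemann zeta function*, Proc. London Math.
  Soc. (3) 85 (2002), 565–633; arXiv:1910.08209. Lemma 5.1 and its proof, (5.1)–(5.6). [Ford2002]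
-/

noncomputable section

open Finset Real Complex

namespace Literature.NumberTheory.LFunctions
namespace FordVK

open VdC VMV

/-! ### The bilinear shift (first display of the proof of Lemma 5.1) -/

/-- **The bilinear shift.** For `|F| ≤ 1`, `N < R ≤ 2N`, and finite sets `A, B` of positive
integers with `ab ≤ N`:
`|A||B| · |∑_{N<n≤R} F(n)| ≤ ∑_{N<n≤R-1} |∑_{a∈A,b∈B} F(n+ab)| + ∑_{a,b} 2ab`.
[cite: Ford2002, proof of Lemma 5.1 (first display)] -/
theorem bilinearShift {F : ℕ → ℂ} (hF : ∀ i, ‖F i‖ ≤ 1) {N R : ℕ} (hNR : N < R)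
    (A B : Finset ℕ) (hA : ∀ a ∈ A, 1 ≤ a) (hB : ∀ b ∈ B, 1 ≤ b)
    (hAB : ∀ a ∈ A, ∀ b ∈ B, a * b ≤ N) :
    (A.card : ℝ) * B.card * ‖∑ n ∈ Ioc N R, F n‖
      ≤ ∑ n ∈ Ioc N (R - 1), ‖∑ a ∈ A, ∑ b ∈ B, F (n + a * b)‖
        + ∑ a ∈ A, ∑ b ∈ B, (2 * (a * b : ℕ) : ℝ) := by
  set S := ∑ n ∈ Ioc N R, F n with hS
  set Bn := Ioc N (R - 1) with hBn
  -- error of the range replacement for one shift `m = ab`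
  have herr : ∀ m : ℕ, 1 ≤ m → m ≤ N → ‖S - ∑ n ∈ Bn, F (n + m)‖ ≤ 2 * m := by
    intro m hm1 hmN
    rw [hS, sum_Ioc_eq_sum_Ioc_sub_add F hmN hNR.le]
    refine (norm_sum_sub_sum_le_card (Ioc (N - m) (R - m)) Bn (g := fun n => F (n + m))
      (fun i => hF _)).trans ?_
    have h1 : (Ioc (N - m) (R - m) \ Bn).card ≤ m := by
      calc (Ioc (N - m) (R - m) \ Bn).card ≤ (Ioc (N - m) N).card := by
            refine Finset.card_le_card fun x hx => ?_
            simp only [hBn, Finset.mem_sdiff, Finset.mem_Ioc, not_and, not_le] at hx ⊢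
            omega
        _ = m := by rw [Nat.card_Ioc]; omega
    have h2 : (Bn \ Ioc (N - m) (R - m)).card ≤ m := by
      calc (Bn \ Ioc (N - m) (R - m)).card ≤ (Ioc (R - m) (R - 1)).card := by
            refine Finset.card_le_card fun x hx => ?_
            simp only [hBn, Finset.mem_sdiff, Finset.mem_Ioc, not_and, not_le] at hx ⊢
            omega
        _ ≤ m := by rw [Nat.card_Ioc]; omega
    have h1' : ((Ioc (N - m) (R - m) \ Bn).card : ℝ) ≤ m := by exact_mod_cast h1
    have h2' : ((Bn \ Ioc (N - m) (R - m)).card : ℝ) ≤ m := by exact_mod_cast h2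
    linarith
  -- sum over `(a, b)`
  have hmain : ‖∑ a ∈ A, ∑ b ∈ B, (S - ∑ n ∈ Bn, F (n + a * b))‖
      ≤ ∑ a ∈ A, ∑ b ∈ B, (2 * (a * b : ℕ) : ℝ) := by
    refine (norm_sum_le _ _).trans (Finset.sum_le_sum fun a ha => ?_)
    refine (norm_sum_le _ _).trans (Finset.sum_le_sum fun b hb => ?_)
    have := herr (a * b) (Nat.one_le_iff_ne_zero.2 (Nat.mul_ne_zero (by have := hA a ha; omega)
      (by have := hB b hb; omega))) (hAB a ha b hb)
    exact_mod_cast this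
  have hsplit : ∑ a ∈ A, ∑ b ∈ B, (S - ∑ n ∈ Bn, F (n + a * b))
      = (A.card : ℂ) * B.card * S - ∑ n ∈ Bn, ∑ a ∈ A, ∑ b ∈ B, F (n + a * b) := by
    simp only [Finset.sum_sub_distrib, Finset.sum_const, nsmul_eq_mul]
    rw [Finset.sum_comm (s := Bn) (t := A)]
    congr 1
    · ring
    · exact Finset.sum_congr rfl fun a _ => Finset.sum_comm
  rw [hsplit] at hmain
  have hnorm : ‖(A.card : ℂ) * B.card * S‖ = (A.card : ℝ) * B.card * ‖S‖ := by
    rw [norm_mul, norm_mul, Complex.norm_natCast, Complex.norm_natCast]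
  calc (A.card : ℝ) * B.card * ‖S‖ = ‖(A.card : ℂ) * B.card * S‖ := hnorm.symm
    _ ≤ ‖(A.card : ℂ) * B.card * S - ∑ n ∈ Bn, ∑ a ∈ A, ∑ b ∈ B, F (n + a * b)‖
        + ‖∑ n ∈ Bn, ∑ a ∈ A, ∑ b ∈ B, F (n + a * b)‖ := norm_le_norm_sub_add _ _
    _ ≤ ∑ a ∈ A, ∑ b ∈ B, (2 * (a * b : ℕ) : ℝ) + ∑ n ∈ Bn, ‖∑ a ∈ A, ∑ b ∈ B, F (n + a * b)‖ :=
        add_le_add hmain (norm_sum_le _ _)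
    _ = _ := by ring

/-! ### The Taylor remainder of `-(t/2π) log(1 + m/z)` -/

/-- **The Taylor remainder** (Ford (5.1) for the phase): with `γ = γ(z)` the Taylor coefficients
(`gam t z k`) and `φ = phi t z γ` the remainder, `|φ(m)| ≤ (t/2π) m^{k+1}/((k+1) z^{k+1})` for
`0 ≤ m`. [cite: Ford2002, (5.1)–(5.2)] -/
theorem abs_phi_gam_le {t z : ℝ} (ht : 0 ≤ t) (hz : 0 < z) (k : ℕ) {m : ℝ} (hm : 0 ≤ m) :
    |phi t z (gam t z k) m| ≤ t / (2 * π) * m ^ (k + 1) / ((k + 1) * z ^ (k + 1)) := by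
  -- `|φ'(w)| ≤ (t/2π) w^k / z^{k+1}` for `w ≥ 0`
  have hderiv : ∀ w, 0 ≤ w → |phi' t z (gam t z k) w| ≤ t / (2 * π) * w ^ k / z ^ (k + 1) := by
    intro w hw
    have := abs_phi'_le ht hz (gam t z k) hw (k := k)
    simp only [sub_self, abs_zero, mul_zero, zero_mul, Finset.sum_const_zero, add_zero] at this
    exact this
  -- the majorant `H(w) = (t/2π) w^{k+1}/((k+1) z^{k+1})` and the two monotone functions `H ∓ φ`
  set H : ℝ → ℝ := fun w => t / (2 * π) * w ^ (k + 1) / ((k + 1) * z ^ (k + 1)) with hH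
  have hH' : ∀ w, HasDerivAt H (t / (2 * π) * w ^ k / z ^ (k + 1)) w := by
    intro w
    have := ((hasDerivAt_pow (k + 1) w).const_mul (t / (2 * π))).div_const (((k : ℝ) + 1) * z ^ (k + 1))
    simp only [Nat.add_sub_cancel, Nat.cast_add, Nat.cast_one] at this
    rw [hH]
    refine this.congr_deriv ?_
    have hk : (k : ℝ) + 1 ≠ 0 := by positivity
    field_simp
  have hphi0 : phi t z (gam t z k) 0 = 0 := by
    unfold phi poly; simp
  have hH0 : H 0 = 0 := by rw [hH]; simp
  have hmono : ∀ (σ : ℝ), (σ = 1 ∨ σ = -1) →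
      MonotoneOn (fun w => H w + σ * phi t z (gam t z k) w) (Set.Ici 0) := by
    intro σ hσ
    refine monotoneOn_of_hasDerivWithinAt_nonneg (convex_Ici 0)
      (f' := fun w => t / (2 * π) * w ^ k / z ^ (k + 1) + σ * phi' t z (gam t z k) w) ?_ ?_ ?_
    · exact ((continuous_const.mul (continuous_pow _)).div_const _).continuousOn.add
        (continuousOn_const.mul (fun w hw => (hasDerivAt_phi t hz _ hw).continuousAt.continuousWithinAt))
    · intro w hw
      rw [interior_Ici] at hw
      exact ((hH' w).add ((hasDerivAt_phi t hz _ (le_of_lt hw)).const_mul σ)).hasDerivWithinAt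
    · intro w hw
      rw [interior_Ici] at hw
      have h1 := hderiv w (le_of_lt hw)
      rw [abs_le] at h1
      rcases hσ with h | h <;> rw [h] <;> linarith [h1.1, h1.2]
  have hplus := hmono 1 (Or.inl rfl) (Set.mem_Ici.2 le_rfl) (Set.mem_Ici.2 hm) hm
  have hminus := hmono (-1) (Or.inr rfl) (Set.mem_Ici.2 le_rfl) (Set.mem_Ici.2 hm) hm
  simp only [hH0, hphi0, mul_zero, add_zero, one_mul, neg_mul] at hplus hminus
  rw [abs_le]
  constructor <;> [linarith; linarith]


/-! ### The sets `𝒟_j` and the numbers `W_j` -/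

/-- `‖-x‖ = ‖x‖` for the distance to the nearest integer. [folklore] -/
theorem abs_neg_sub_round (x : ℝ) : |-x - round (-x)| = |x - round x| := by
  rw [abs_sub_round_eq_min, abs_sub_round_eq_min]
  by_cases h : Int.fract x = 0
  · rw [Int.fract_neg_eq_zero.2 h, h]
  · rw [Int.fract_neg h, sub_sub_cancel, min_comm]

/-- `‖γd‖ = ‖|γ|d‖`. [folklore] -/
theorem abs_sub_round_abs_mul (γ d : ℝ) : |(|γ| * d) - round (|γ| * d)| = |γ * d - round (γ * d)| := by
  rcases le_or_gt 0 γ with h | h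
  · rw [abs_of_nonneg h]
  · rw [abs_of_neg h, neg_mul, abs_neg_sub_round]

/-- Ford's `W_j = min(2sM₂^j, 2sM₂^j/(rM^j) + stM₂^j/(πjN^j) + 4πj(2N)^j/(rtM^j) + 2)` (`M = ⌊M₁⌋`).
[cite: Ford2002, Lemma 5.1] -/
def Wj (s r N M : ℕ) (M₂ t : ℝ) (j : ℕ) : ℝ :=
  min (2 * s * M₂ ^ j)
    (2 * s * M₂ ^ j / (r * (M : ℝ) ^ j) + s * t * M₂ ^ j / (π * j * (N : ℝ) ^ j)
      + 4 * π * j * (2 * (N : ℝ)) ^ j / (r * t * (M : ℝ) ^ j) + 2)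

/-- **`|𝒟_j| ≤ W_j`** (Ford (5.6) applied with `K = s(P₂^j - 1)`, `δ = 1/(2rM^j)`,
`γ = |γ_j(z)| = t/(2πj z^j)`, `N ≤ z ≤ 2N`). [cite: Ford2002, proof of Lemma 5.1 ("Putting
`K = sM₂^j - 1`, … gives `|𝒟_j| ≤ W_j`")] -/
theorem card_Dj_le_Wj {s r M N P₂ j : ℕ} {M₂ t z : ℝ} (hs : 1 ≤ s) (hr : 1 ≤ r) (hM : 1 ≤ M)
    (hN : 1 ≤ N) (hP₂ : 1 ≤ P₂) (hP₂M₂ : (P₂ : ℝ) ≤ M₂) (ht : 0 < t) (hz1 : (N : ℝ) ≤ z)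
    (hz2 : z ≤ 2 * N) (hj : 1 ≤ j) :
    ((((Finset.Icc (-((s * P₂ ^ j - s : ℕ) : ℤ)) ((s * P₂ ^ j - s : ℕ) : ℤ)).filter
        fun d : ℤ => |t / (2 * π * j) * (-1 / z) ^ j * (d : ℝ)
          - round (t / (2 * π * j) * (-1 / z) ^ j * (d : ℝ))| < 1 / (2 * (r * (M : ℝ) ^ j))).card : ℕ) : ℝ)
      ≤ Wj s r N M M₂ t j := by
  set K : ℕ := s * P₂ ^ j - s with hK
  set γ : ℝ := t / (2 * π * j) * (-1 / z) ^ j with hγ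
  set δ : ℝ := 1 / (2 * (r * (M : ℝ) ^ j)) with hδ
  set D := (Finset.Icc (-(K : ℤ)) (K : ℤ)).filter fun d : ℤ => |γ * (d : ℝ) - round (γ * (d : ℝ))| < δ with hD
  have hz0 : 0 < z := lt_of_lt_of_le (by exact_mod_cast hN) hz1
  have hNpos : (0 : ℝ) < N := by exact_mod_cast hN
  have hMpos : (0 : ℝ) < M := by exact_mod_cast hM
  have hjpos : (0 : ℝ) < j := by exact_mod_cast hj
  have hsle : s ≤ s * P₂ ^ j := Nat.le_mul_of_pos_right s (pow_pos hP₂ _)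
  have hKreal : (K : ℝ) = s * (P₂ : ℝ) ^ j - s := by
    rw [hK]; push_cast [Nat.cast_sub hsle]; ring
  have hKle : (K : ℝ) ≤ s * M₂ ^ j := by
    rw [hKreal]
    have h1 : (P₂ : ℝ) ^ j ≤ M₂ ^ j := pow_le_pow_left₀ (Nat.cast_nonneg _) hP₂M₂ _
    have h2 : (0 : ℝ) ≤ s := Nat.cast_nonneg _
    nlinarith
  have hK0 : (0 : ℝ) ≤ K := Nat.cast_nonneg _
  -- `|γ| = t/(2πj z^j)`
  have habsγ : |γ| = t / (2 * π * j * z ^ j) := by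
    rw [hγ, abs_mul, abs_of_pos (by positivity : 0 < t / (2 * π * j)), abs_pow, abs_div, abs_neg,
      abs_one, abs_of_pos hz0, one_div_pow]
    field_simp
  have hγpos : 0 < |γ| := by rw [habsγ]; positivity
  have hδpos : 0 < δ := by rw [hδ]; positivity
  change ((D.card : ℕ) : ℝ) ≤ _
  unfold Wj
  refine le_min ?_ ?_
  · -- the trivial bound `|𝒟_j| ≤ 2K + 1 ≤ 2 s M₂^j`
    have h1 : D.card ≤ (Finset.Icc (-(K : ℤ)) (K : ℤ)).card := Finset.card_le_card (Finset.filter_subset _ _)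
    rw [Int.card_Icc, show (K : ℤ) + 1 - -(K : ℤ) = ((2 * K + 1 : ℕ) : ℤ) by push_cast; ring,
      Int.toNat_natCast] at h1
    have h2 : (D.card : ℝ) ≤ 2 * K + 1 := by exact_mod_cast h1
    have h3 : (1 : ℝ) ≤ s := by exact_mod_cast hs
    have h4 : (2 : ℝ) * K + 1 ≤ 2 * s * M₂ ^ j := by
      rw [hKreal]
      have : (P₂ : ℝ) ^ j ≤ M₂ ^ j := pow_le_pow_left₀ (Nat.cast_nonneg _) hP₂M₂ _
      nlinarith
    linarith
  · -- Ford (5.6)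
    have hS : ∀ d ∈ D, |(d : ℝ)| ≤ K ∧ |d * |γ| - round (d * |γ|)| < δ := by
      intro d hd
      rw [hD, Finset.mem_filter, Finset.mem_Icc] at hd
      constructor
      · rw [abs_le]; exact ⟨by exact_mod_cast hd.1.1, by exact_mod_cast hd.1.2⟩
      · rw [mul_comm, abs_sub_round_abs_mul]; exact hd.2
    refine (card_near_int_le hK0 hγpos hδpos D hS).trans ?_
    rw [habsγ, hδ]
    -- compare term by term
    have hzj1 : (N : ℝ) ^ j ≤ z ^ j := pow_le_pow_left₀ hNpos.le hz1 _
    have hzj2 : z ^ j ≤ (2 * (N : ℝ)) ^ j := pow_le_pow_left₀ hz0.le hz2 _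
    have t1 : 4 * (K : ℝ) * (1 / (2 * (r * (M : ℝ) ^ j))) ≤ 2 * s * M₂ ^ j / (r * (M : ℝ) ^ j) := by
      rw [show 4 * (K : ℝ) * (1 / (2 * (r * (M : ℝ) ^ j))) = 2 * K / (r * (M : ℝ) ^ j) by field_simp; ring]
      exact div_le_div_of_nonneg_right (by linarith) (by positivity)
    have t2 : 2 * (K : ℝ) * (t / (2 * π * j * z ^ j)) ≤ s * t * M₂ ^ j / (π * j * (N : ℝ) ^ j) := by
      rw [show 2 * (K : ℝ) * (t / (2 * π * j * z ^ j)) = K * t / (π * j * z ^ j) by field_simp]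
      calc (K : ℝ) * t / (π * j * z ^ j) ≤ K * t / (π * j * (N : ℝ) ^ j) := by
            refine div_le_div_of_nonneg_left (by positivity) (by positivity) ?_
            exact mul_le_mul_of_nonneg_left hzj1 (by positivity)
        _ ≤ s * M₂ ^ j * t / (π * j * (N : ℝ) ^ j) := by
            refine div_le_div_of_nonneg_right ?_ (by positivity)
            exact mul_le_mul_of_nonneg_right hKle ht.le
        _ = _ := by ring
    have t3 : 4 * (1 / (2 * (r * (M : ℝ) ^ j))) / (t / (2 * π * j * z ^ j))
        ≤ 4 * π * j * (2 * (N : ℝ)) ^ j / (r * t * (M : ℝ) ^ j) := by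
      rw [show 4 * (1 / (2 * (r * (M : ℝ) ^ j))) / (t / (2 * π * j * z ^ j))
          = 4 * π * j * z ^ j / (r * t * (M : ℝ) ^ j) by field_simp]
      refine div_le_div_of_nonneg_right ?_ (by positivity)
      exact mul_le_mul_of_nonneg_left hzj2 (by positivity)
    linarith


/-! ### Assembly: Lemma 5.1 -/

/-- The phase of one term: `e(P_γ(ab))` is the character `E(ν(a), θ_b)`. [folklore] -/
theorem e_poly_mul_eq_E (k : ℕ) (γ : Fin k → ℝ) (a b : ℤ) :
    e (poly γ ((a : ℝ) * b)) = E (nu k a) (thetaB γ b) := by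
  rw [E_nu_eq_e_poly]
  congr 1
  unfold poly thetaB
  refine Finset.sum_congr rfl fun j _ => ?_
  rw [mul_pow]; ring

/-- The double sum of the main phases is `U = ∑_b V_b`. [folklore] -/
theorem sum_sum_e_poly_eq_U (k M : ℕ) (BB : Finset ℕ) (γ : Fin k → ℝ) :
    ∑ a ∈ Finset.Icc 1 M, ∑ b ∈ BB, e (poly γ ((a : ℝ) * b))
      = ∑ b ∈ BB.map Nat.castEmbedding, tp (Finset.Icc (1 : ℤ) M) (nu k) (thetaB γ b) := by
  rw [Finset.sum_comm, Finset.sum_map]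
  refine Finset.sum_congr rfl fun b _ => ?_
  unfold tp
  rw [show (1 : ℤ) = ((1 : ℕ) : ℤ) by simp, VdC.sum_Icc_int_eq_nat]
  refine Finset.sum_congr rfl fun a _ => ?_
  rw [← e_poly_mul_eq_E]
  simp [Nat.castEmbedding]

/-- From `x^n ≤ y` to `x ≤ y^{1/n}` (`x ≥ 0`, `n ≥ 1`). [folklore] -/
theorem le_rpow_inv_of_pow_le {x y : ℝ} {n : ℕ} (hx : 0 ≤ x) (hn : n ≠ 0)
    (h : x ^ n ≤ y) : x ≤ y ^ (1 / (n : ℝ)) := by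
  calc x = (x ^ n) ^ (1 / (n : ℝ)) := by rw [one_div, Real.pow_rpow_inv_natCast hx hn]
    _ ≤ y ^ (1 / (n : ℝ)) := Real.rpow_le_rpow (by positivity) h (by positivity)

/-- **Ford's Lemma 5.1** (Vinogradov's method with separation of variables). Let `k, r, s ≥ 1`,
`h ≤ g` (any range of exponents), `1 ≤ N < R₀ ≤ 2N`, `0 < u ≤ 1`, `t > 0`, `1 ≤ M₁, M₂` with
`M₁ M₂ ≤ N`, `M = ⌊M₁⌋`, and `ℬ` a nonempty set of integers `1 ≤ b ≤ M₂`. Then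
`|∑_{N<n≤R₀} (n+u)^{-it}| ≤ 2M₁M₂ + t(M₁M₂)^{k+1}/((k+1)N^k) + (N/(M|ℬ|)) Q^{1/(2rs)}`,
`Q = |ℬ|^{2rs-2s} M^{2rs-2r} J_{r,k}(M) · (5r)^k M^{k(k+1)/2} · J_{s,k,[h,g]}(ℬ) · W_h ⋯ W_g`,
`W_j = min(2sM₂^j, 2sM₂^j/(rM^j) + stM₂^j/(πjN^j) + 4πj(2N)^j/(rtM^j) + 2)` (`FordVK.Wj`). Since
`(N/(M|ℬ|)) Q^{1/(2rs)} = N (M₂/|ℬ|)^{1/r} ((5r)^k M₂^{-2s} M^{-2r+k(k+1)/2} J_{r,k}(M) J_{s,g,h}(ℬ) W_h⋯W_g)^{1/(2rs)}`,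
this is the displayed bound of Lemma 5.1 (with `kN^k` improved to `(k+1)N^k`, as in (5.2), and the
hypothesis `M₁M₂ ≤ N` under which (5.1) is applied). [cite: Ford2002, Lemma 5.1] -/
theorem ford_lemma51 {k r s h g N R₀ : ℕ} {t u M₁ M₂ : ℝ} (BB : Finset ℕ)
    (hr : 1 ≤ r) (hs : 1 ≤ s) (hN : 1 ≤ N) (hNR : N < R₀) (hR : R₀ ≤ 2 * N) (hu0 : 0 < u)
    (hu1 : u ≤ 1) (ht : 0 < t) (hM₁ : 1 ≤ M₁) (hM₂ : 1 ≤ M₂) (hM₁M₂ : M₁ * M₂ ≤ N)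
    (hBne : BB.Nonempty) (hBB : ∀ b ∈ BB, 1 ≤ b ∧ (b : ℝ) ≤ M₂) :
    ‖∑ n ∈ Ioc N R₀, ((n : ℂ) + u) ^ (-(t * Complex.I))‖
      ≤ 2 * M₁ * M₂ + t * (M₁ * M₂) ^ (k + 1) / ((k + 1) * (N : ℝ) ^ k)
        + N * ((BB.card : ℝ) ^ (2 * r * s - 2 * s) * (((⌊M₁⌋₊ : ℕ) : ℝ) ^ r) ^ (2 * s - 2)
            * (J k r (Finset.Icc (1 : ℤ) ⌊M₁⌋₊) : ℝ)
            * ((∏ j : Fin k, 5 * (r * ((⌊M₁⌋₊ : ℕ) : ℝ) ^ (j.val + 1)))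
              * (∏ j : Fin k, if h ≤ j.val + 1 ∧ j.val + 1 ≤ g then Wj s r N ⌊M₁⌋₊ M₂ t (j.val + 1) else 1)
              * (Jinc k s (BB.map Nat.castEmbedding) h g : ℝ))) ^ (1 / ((2 * r * s : ℕ) : ℝ))
          / (⌊M₁⌋₊ * BB.card) := by
  -- integer parameters
  set M := ⌊M₁⌋₊ with hMdef
  set P₂ := ⌊M₂⌋₊ with hP₂def
  have hM1 : 1 ≤ M := Nat.le_floor (by simpa using hM₁)
  have hMM₁ : (M : ℝ) ≤ M₁ := Nat.floor_le (by linarith)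
  have hP₂1 : 1 ≤ P₂ := Nat.le_floor (by simpa using hM₂)
  have hP₂M₂ : (P₂ : ℝ) ≤ M₂ := Nat.floor_le (by linarith)
  have hNpos : (0 : ℝ) < N := by exact_mod_cast hN
  have hMpos : (0 : ℝ) < M := by exact_mod_cast hM1
  have hBpos : (0 : ℝ) < BB.card := by exact_mod_cast hBne.card_pos
  set A := Finset.Icc 1 M with hA
  have hAcard : A.card = M := by rw [hA, Nat.card_Icc]; omega
  have hAmem : ∀ a ∈ A, 1 ≤ a ∧ (a : ℝ) ≤ M₁ := fun a ha => by
    rw [hA, Finset.mem_Icc] at ha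
    exact ⟨ha.1, le_trans (by exact_mod_cast ha.2) hMM₁⟩
  have hBBP₂ : ∀ b ∈ BB, 1 ≤ b ∧ b ≤ P₂ := fun b hb =>
    ⟨(hBB b hb).1, Nat.le_floor (hBB b hb).2⟩
  set BBz : Finset ℤ := BB.map Nat.castEmbedding with hBBz
  have hBBzmem : ∀ b ∈ BBz, 1 ≤ b ∧ b ≤ (P₂ : ℤ) := by
    intro b hb
    rw [hBBz, Finset.mem_map] at hb
    obtain ⟨b', hb', rfl⟩ := hb
    have := hBBP₂ b' hb'
    simp only [Nat.castEmbedding_apply]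
    exact ⟨by exact_mod_cast this.1, by exact_mod_cast this.2⟩
  have hBBzcard : BBz.card = BB.card := Finset.card_map _
  -- the summands and the bilinear shift
  set F : ℕ → ℂ := fun n => ((n : ℂ) + u) ^ (-(t * Complex.I)) with hF
  have hF1 : ∀ i, ‖F i‖ ≤ 1 := by
    intro i
    show ‖((i : ℂ) + u) ^ (-(t * Complex.I))‖ ≤ 1
    have := norm_ofReal_cpow_neg_mul_I (x := (i : ℝ) + u) (by positivity) t
    push_cast at this
    exact this.le
  have hAB : ∀ a ∈ A, ∀ b ∈ BB, a * b ≤ N := by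
    intro a ha b hb
    have h1 : ((a * b : ℕ) : ℝ) ≤ N := by
      push_cast
      calc (a : ℝ) * b ≤ M₁ * M₂ := mul_le_mul (hAmem a ha).2 (hBB b hb).2 (Nat.cast_nonneg _) (by linarith)
        _ ≤ N := hM₁M₂
    exact_mod_cast h1
  have step1 := bilinearShift hF1 hNR A BB (fun a ha => (hAmem a ha).1) (fun b hb => (hBB b hb).1) hAB
  rw [hAcard] at step1
  -- the error term `∑ 2ab ≤ M |BB| 2 M₁ M₂`
  have step2 : ∑ a ∈ A, ∑ b ∈ BB, (2 * (a * b : ℕ) : ℝ) ≤ (M : ℝ) * BB.card * (2 * M₁ * M₂) := by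
    calc ∑ a ∈ A, ∑ b ∈ BB, (2 * (a * b : ℕ) : ℝ) ≤ ∑ _a ∈ A, ∑ _b ∈ BB, 2 * M₁ * M₂ := by
          refine Finset.sum_le_sum fun a ha => Finset.sum_le_sum fun b hb => ?_
          push_cast
          have := mul_le_mul (hAmem a ha).2 (hBB b hb).2 (Nat.cast_nonneg _) (by linarith)
          linarith
      _ = (M : ℝ) * BB.card * (2 * M₁ * M₂) := by
          rw [Finset.sum_const, Finset.sum_const, nsmul_eq_mul, nsmul_eq_mul, hAcard]; ring
  -- the uniform bound for the inner double sums
  set E₁ : ℝ := t * (M₁ * M₂) ^ (k + 1) / ((k + 1) * (N : ℝ) ^ (k + 1)) with hE₁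
  set Q : ℝ := (BB.card : ℝ) ^ (2 * r * s - 2 * s) * ((M : ℝ) ^ r) ^ (2 * s - 2)
      * (J k r (Finset.Icc (1 : ℤ) M) : ℝ)
      * ((∏ j : Fin k, 5 * (r * (M : ℝ) ^ (j.val + 1)))
        * (∏ j : Fin k, if h ≤ j.val + 1 ∧ j.val + 1 ≤ g then Wj s r N M M₂ t (j.val + 1) else 1)
        * (Jinc k s BBz h g : ℝ)) with hQ
  have hWj0 : ∀ j : ℕ, 0 ≤ Wj s r N M M₂ t j := fun j => by
    unfold Wj
    refine le_min (by positivity) (by positivity)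
  have hQ0 : 0 ≤ Q := by
    rw [hQ]
    have : 0 ≤ ∏ j : Fin k, (if h ≤ j.val + 1 ∧ j.val + 1 ≤ g then Wj s r N M M₂ t (j.val + 1) else 1) :=
      Finset.prod_nonneg fun j _ => by split_ifs; exacts [hWj0 _, zero_le_one]
    positivity
  have step3 : ∀ n ∈ Ioc N (R₀ - 1),
      ‖∑ a ∈ A, ∑ b ∈ BB, F (n + a * b)‖ ≤ Q ^ (1 / ((2 * r * s : ℕ) : ℝ)) + (M : ℝ) * BB.card * E₁ := by
    intro n hn
    rw [Finset.mem_Ioc] at hn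
    set z : ℝ := n + u with hz
    have hz1 : (N : ℝ) ≤ z := by
      have : (N : ℝ) + 1 ≤ n := by exact_mod_cast hn.1
      rw [hz]; linarith
    have hz2 : z ≤ 2 * N := by
      have : (n : ℝ) + 1 ≤ 2 * N := by
        have h' : n + 1 ≤ 2 * N := by omega
        exact_mod_cast h'
      rw [hz]; linarith
    have hz0 : 0 < z := lt_of_lt_of_le hNpos hz1
    set γ := gam t z k with hγ
    -- factor out `(n+u)^{-it}` and split each phase into polynomial + remainder
    have hterm : ∀ a b : ℕ, F (n + a * b)
        = e (-(t / (2 * π)) * Real.log z) * e (poly γ ((a : ℝ) * b) + phi t z γ ((a : ℝ) * b)) := by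
      intro a b
      rw [hF]
      show (((n + a * b : ℕ) : ℂ) + u) ^ (-(t * Complex.I)) = _
      rw [cpow_shift_eq t hu0 n (a * b)]
      congr 1
      congr 1
      unfold phi
      push_cast
      rw [hz]
      ring
    have hsplit : ∑ a ∈ A, ∑ b ∈ BB, F (n + a * b)
        = e (-(t / (2 * π)) * Real.log z) * (∑ a ∈ A, ∑ b ∈ BB, e (poly γ ((a : ℝ) * b))
          + ∑ a ∈ A, ∑ b ∈ BB, (e (poly γ ((a : ℝ) * b) + phi t z γ ((a : ℝ) * b))
              - e (poly γ ((a : ℝ) * b)))) := by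
      rw [← Finset.sum_add_distrib, Finset.mul_sum]
      refine Finset.sum_congr rfl fun a _ => ?_
      rw [← Finset.sum_add_distrib, Finset.mul_sum]
      refine Finset.sum_congr rfl fun b _ => ?_
      rw [hterm]; ring
    -- the remainder terms
    have hrem : ∀ a ∈ A, ∀ b ∈ BB,
        ‖e (poly γ ((a : ℝ) * b) + phi t z γ ((a : ℝ) * b)) - e (poly γ ((a : ℝ) * b))‖ ≤ E₁ := by
      intro a ha b hb
      have hm0 : (0 : ℝ) ≤ (a : ℝ) * b := by positivity
      have hm1 : (a : ℝ) * b ≤ M₁ * M₂ := mul_le_mul (hAmem a ha).2 (hBB b hb).2 (Nat.cast_nonneg _) (by linarith)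
      refine (norm_e_sub_e_le _ _).trans ?_
      rw [add_sub_cancel_left]
      have hphi := abs_phi_gam_le ht.le hz0 k hm0
      rw [hγ]
      calc 2 * π * |phi t z (gam t z k) ((a : ℝ) * b)|
          ≤ 2 * π * (t / (2 * π) * ((a : ℝ) * b) ^ (k + 1) / ((k + 1) * z ^ (k + 1))) := by gcongr
        _ = t * ((a : ℝ) * b) ^ (k + 1) / ((k + 1) * z ^ (k + 1)) := by field_simp
        _ ≤ t * (M₁ * M₂) ^ (k + 1) / ((k + 1) * (N : ℝ) ^ (k + 1)) := by
            gcongr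
        _ = E₁ := by rw [hE₁]
    -- the main term through `norm_U_pow_le`
    have hU : ‖∑ a ∈ A, ∑ b ∈ BB, e (poly γ ((a : ℝ) * b))‖ ≤ Q ^ (1 / ((2 * r * s : ℕ) : ℝ)) := by
      rw [hA, sum_sum_e_poly_eq_U k M BB γ, ← hBBz]
      refine le_rpow_inv_of_pow_le (norm_nonneg _) (by positivity) ?_
      refine (norm_U_pow_le (h := h) (g := g) hr hs hM1 BBz hBBzmem γ).trans ?_
      rw [hQ, hBBzcard]
      refine mul_le_mul_of_nonneg_left ?_ (by positivity)
      refine mul_le_mul_of_nonneg_right (mul_le_mul_of_nonneg_left ?_ ?_) (Nat.cast_nonneg _)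
      · refine Finset.prod_le_prod (fun j _ => by split_ifs <;> positivity) fun j _ => ?_
        split_ifs with hj
        · have := card_Dj_le_Wj (M₂ := M₂) (j := j.val + 1) hs hr hM1 hN hP₂1 hP₂M₂ ht hz1 hz2 (by omega)
          rw [hγ]
          unfold gam
          exact_mod_cast this
        · exact le_rfl
      · exact Finset.prod_nonneg fun j _ => by positivity
    -- combine
    rw [hsplit, norm_mul, norm_e, one_mul]
    refine (norm_add_le _ _).trans (add_le_add hU ?_)
    refine (norm_sum_le _ _).trans ((Finset.sum_le_sum fun a ha => (norm_sum_le _ _).trans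
      (Finset.sum_le_sum fun b hb => hrem a ha b hb)).trans (le_of_eq ?_))
    rw [Finset.sum_const, Finset.sum_const, nsmul_eq_mul, nsmul_eq_mul, hAcard]; ring
  -- sum over `n`
  have hcardn : ((Ioc N (R₀ - 1)).card : ℝ) ≤ N := by
    rw [Nat.card_Ioc]
    have : R₀ - 1 - N ≤ N := by omega
    exact_mod_cast this
  have step4 : ∑ n ∈ Ioc N (R₀ - 1), ‖∑ a ∈ A, ∑ b ∈ BB, F (n + a * b)‖
      ≤ N * (Q ^ (1 / ((2 * r * s : ℕ) : ℝ)) + (M : ℝ) * BB.card * E₁) := by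
    refine (Finset.sum_le_sum step3).trans ?_
    rw [Finset.sum_const, nsmul_eq_mul]
    exact mul_le_mul_of_nonneg_right hcardn (by positivity)
  -- conclude
  have hMB : (0 : ℝ) < (M : ℝ) * BB.card := by positivity
  have htot := step1.trans (add_le_add step4 step2)
  have hdiv : ‖∑ n ∈ Ioc N R₀, F n‖
      ≤ (N * (Q ^ (1 / ((2 * r * s : ℕ) : ℝ)) + (M : ℝ) * BB.card * E₁) + (M : ℝ) * BB.card * (2 * M₁ * M₂))
          / ((M : ℝ) * BB.card) := by
    rw [le_div_iff₀ hMB]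
    linarith
  refine hdiv.trans (le_of_eq ?_)
  have hN0 : (N : ℝ) ≠ 0 := hNpos.ne'
  have hM0 : (M : ℝ) ≠ 0 := hMpos.ne'
  have hB0 : (BB.card : ℝ) ≠ 0 := hBpos.ne'
  have hk0 : (k : ℝ) + 1 ≠ 0 := by positivity
  rw [hE₁]
  field_simp
  ring

end FordVK
end Literature.NumberTheory.LFunctions
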